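import Summits.Langlands.Langlands.Theorems.IrreducibilityBySelfDualityPairLBoundaryJSLocalSingleDatum
import Summits.Langlands.Langlands.Theorems.IrreducibilityBySelfDualityPairLBoundaryJSWhittakerShiftTorusOffIntegral
import Literature.NumberTheory.Automorphic.PairLFunctionNeConjLevelOneOfTestVector
import Literature.NumberTheory.Automorphic.ThinTestFunction

/-!
# Crux `PairLBoundaryJS` (stmt-Langlands-13622), line `Sketch` — the local Rankin–Selberg theory of a
# cuspidal pair in translate form (registered stub `stub_local_pair_translate`, LOCAL★)

Summit `Langlands`, sub-problem `Langlands`, helper file under `Theorems/` supporting the crux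
`PairLBoundaryJS` (Arthur–Clozel (1989), Ch. 3, (2.2)), line `Sketch`, lead c3. This file closes the
lead's stub of skeleton v12: for cuspidal `P`, `Q ≤ L²_cusp(GL_{n+1}(K) A_G \ GL_{n+1}(𝔸_K))` with
`P ⟂ Q` or `P = Q` and a finite set `S₀` of finite places off which both are unramified, there are a
torus of Whittaker shifts `τ` (last entry `1`, correcting the conductor of Tate's character off `S₀`),
finitely many data `(f_i ∈ P, f'_i ∈ Q, η_i, Φ_i)` with ONE level `𝔫₀` supported on `S₀` and `Φ_i ≥ 0`
continuous Schwartz–Bruhat spherical off `S₀`, constants `c_i` and an ENTIRE `Λ` with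
`Λ(s) · Σ_i c_i · ∫_{B({v ∉ S₀}) × K} W_{S_{η_i} f_i}(diag τ ·) W̄_{S_{η_i} f'_i}(diag τ ·) Φ_i(e ·) |det|^s δ⁻¹ = 1`
for `re s > 1` — granted the archimedean named fact `HumphriesJo2024_archRankinSelberg_testVector`.

Assembly (everything deep is a landed theorem of the line): the torus with integrality off the different
(`WhittakerShiftTorusOffIntegral.stub_whittakerShiftTorus_off_integral`); the archimedean components
`τ_P`, `τ_Q` (`exists_archComponent_decomposition`); initial pure tensors `S₁ ∈ π_f`, `S₁' ∈ σ_f` of levels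
supported on `S₀` with non-zero translated transferred Whittaker functionals `ℓ = Φ_λ(τ_f S₁)`,
`ℓ' = Φ_λ(τ_f S₁')` (`InitialVectorTranslateNeZero.stub_initialVector_translate_ne_zero`); the archimedean
data `(e_i, e'_i, Φ_{i,∞}, Λ)` with `Λ Σ_i Ψ_∞(s; e_i, e'_i, Φ_{i,∞}) = 1` (`archPairLFactorData_of_testVector`
on the named fact, for the image Haar measures on `(K_∞ˣ)^{n+1}` and `K_∞`); the realisation of each
datum in the translated thin box integral with a constant `κ_i > 0`
(`LocalSingleDatum.stub_local_single_datum`); and `c_i := κ_i⁻¹`, `Φ_i := thinTestFun Φ_{i,∞} S₀ m_i`,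
`𝔫₀ := ∏_i 𝔫_i`. References: Jacquet–Piatetski-Shapiro–Shalika (1983), Thm. 2.7; Cogdell (2004), §3.2,
§4.1; Humphries–Jo (2024), Thm. 1.1; Mœglin–Waldspurger (1989), Appendice.
-/

noncomputable section

-- `Summit.Langlands.Langlands.…` (summit = sub-problem name, D-0017 layout) trips `dupNamespace`
set_option linter.dupNamespace false

open scoped MatrixGroups Topology Pointwise ENNReal NNReal ComplexConjugate InnerProductSpace ContDiff
-- the place subtypes indexing `mixedSpace K` are `Fintype` classically (`NormedCommRing (mixedSpace K)`)
open scoped Classical Matrix.Norms.Operator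
open NumberField IsDedekindDomain MeasureTheory Measure Matrix Set Filter WithZero
open NumberField.mixedEmbedding
open Literature.NumberTheory.Automorphic AdelicGroupData
open Literature.NumberTheory.GaloisRepresentations (ideleGroup HeckeCharacter)
open ValuativeRel

-- the automorphic quotient carries the tree's Borel σ-algebra, not Mathlib's quotient σ-algebra
attribute [-instance] Quotient.instMeasurableSpace QuotientGroup.measurableSpace

-- the house local instances, exactly as in `RankinSelbergUnfoldingIdentity`
attribute [local instance] adelicBorel borelSpace_adelic locallyCompactSpace_adelic secondCountableTopology_gl_adelic
  glAdeleBorel borelSpace_glAdele borelSpace_ideleGroup secondCountableTopology_ideleGroup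

-- Mathlib idiom: the commutator Lie ring on matrices, to mention `(archGroupGL n K).lie`
attribute [local instance 100] LieRing.ofAssociativeRing

-- Borel structures on the archimedean unit groups (house pattern of `ArchRankinSelbergPairBridge`)
attribute [local instance] Literature.MeasureTheory.Group.Units.borelSpace_of_isOpenEmbedding
  Literature.MeasureTheory.Group.Units.secondCountableTopology
  Literature.MeasureTheory.Group.Units.locallyCompactSpace

namespace Summit.Langlands.Langlands.Theorems.LocalPairTranslate

/-- **The prime factors of a finite product of non-zero ideals of `𝓞 K` indexed by `Fin k` are prime
factors of one of them.** [folklore] -/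
theorem exists_dvd_of_dvd_prod {K : Type} [Field K] [NumberField K] {k : ℕ} (𝔫 : Fin k → Ideal (𝓞 K))
    {w : HeightOneSpectrum (𝓞 K)} (hw : w.asIdeal ∣ ∏ i, 𝔫 i) : ∃ i, w.asIdeal ∣ 𝔫 i := by
  obtain ⟨i, -, hi⟩ := w.prime.exists_mem_finset_dvd hw
  exact ⟨i, hi⟩

set_option maxHeartbeats 1600000 in
/-- **Registered stub `stub_local_pair_translate` (LOCAL★) of the crux skeleton `PairLBoundaryJS`, line
`Sketch`: the local Rankin–Selberg theory of a cuspidal pair in translate form, granted the archimedean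
named fact.** See the module docstring for the statement and the assembly.
[cite: JacquetPiatetskiShapiroShalika1983, Thm. 2.7] [cite: CogdellAnalyticTheory2004, §3.2 and §4.1]
[cite: HumphriesJo2024, Thm. 1.1 and Thm. 5.6] -/
theorem stub_local_pair_translate :
    (∀ (N : ℕ) (K : Type) [Field K] [NumberField K], HumphriesJo2024_archRankinSelberg_testVector N K) →
    ∀ {n : ℕ} {K : Type} [Field K] [NumberField K]
      {μ : Measure (AdelicGroupData.gl (n + 1) K).automorphicQuotient} [(AdelicGroupData.gl (n + 1) K).IsAutomorphicMeasure μ]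
      [MeasurableSpace (AdeleRing (𝓞 K) K)] [BorelSpace (AdeleRing (𝓞 K) K)]
      (νA : Measure (Fin (n + 1) → ideleGroup K)) [IsHaarMeasure νA]
      (νK : Measure ↥(maximalCompactAdelic (n + 1) K)) [IsHaarMeasure νK]
      (ν₀ : Measure ↥(adelicUnipotent (n + 1) K)) [IsHaarMeasure ν₀]
      (P Q : CuspidalAutomorphicRepGL (n + 1) K μ), (P.1.toSubmodule ⟂ Q.1.toSubmodule ∨ P = Q) →
      ∀ (S₀ : Finset (HeightOneSpectrum (𝓞 K))), (∀ v ∉ S₀, IsUnramifiedAt P.1 v ∧ IsUnramifiedAt Q.1 v) →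
      ∃ (τ : Fin (n + 1) → ideleGroup K), lastEntry τ = 1 ∧
      (∀ v ∉ S₀, ∃ (d : Fin (n + 1) → (v.adicCompletion K)ˣ) (a : (v.adicCompletion K)ˣ),
        localComponent v (glDiagonal (n + 1) (AdeleRing (𝓞 K) K) τ) = diagonalGL (Fin (n + 1)) (v.adicCompletion K) d ∧
        (∀ i j : Fin (n + 1), (i : ℕ) + 1 = j → (d i : v.adicCompletion K) * ((d j)⁻¹ : (v.adicCompletion K)ˣ) = a) ∧
        (∀ c ∈ 𝒪[v.adicCompletion K], (adeleAddChar K).adicComponent v (a * c) = 1) ∧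
        ∀ ϖ : v.adicCompletion K, Valued.v ϖ = WithZero.exp (-1 : ℤ) →
          ∃ c ∈ 𝒪[v.adicCompletion K], (adeleAddChar K).adicComponent v (a * (ϖ⁻¹ * c)) ≠ 1) ∧
      ∃ (k : ℕ) (c : Fin k → ℂ) (f : Fin k → P.1.toSubmodule) (f' : Fin k → Q.1.toSubmodule) (𝔫₀ : Ideal (𝓞 K)),
      𝔫₀ ≠ 0 ∧ (∀ w : HeightOneSpectrum (𝓞 K), w.asIdeal ∣ 𝔫₀ → w ∈ S₀) ∧
      ∃ (η : Fin k → (AdelicGroupData.gl (n + 1) K).Adelic → ℝ), (∀ i, IsTestFunctionGL (n + 1) K (η i)) ∧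
      (∀ i, ∀ u : (AdelicGroupData.gl (n + 1) K).Adelic, u ∈ principalCongruenceLevel (n + 1) K 𝔫₀ → ∀ g : (AdelicGroupData.gl (n + 1) K).Adelic, η i (u * g) = η i g) ∧
      ∃ (Φ : Fin k → (Fin (n + 1) → AdeleRing (𝓞 K) K) → ℝ), (∀ i, Continuous (Φ i)) ∧ (∀ i y, 0 ≤ Φ i y) ∧
      (∀ i, (fun y => ((Φ i y : ℝ) : ℂ)) ∈ piSchwartzBruhat K (Fin (n + 1))) ∧
      (∀ i, ∀ v ∉ S₀, IsLastRowSphericalAt (n + 1) K (Φ i) v) ∧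
      (∀ i, ∀ v ∉ S₀, ∀ y : Fin (n + 1) → AdeleRing (𝓞 K) K, Φ i y ≠ 0 → ∀ j, Valued.v ((y j).2 v) ≤ 1) ∧
      ∃ Λ : ℂ → ℂ, Differentiable ℂ Λ ∧ ∀ s : ℂ, 1 < s.re →
      Λ s * ∑ i, c i * ∫ p in unitBox {v | v ∉ (↑S₀ : Set (HeightOneSpectrum (𝓞 K)))} ×ˢ Set.univ,
        torusPairIntegrandC (n + 1) K
          (fun g => whittakerCoeff ν₀ (unipotentTateDomain (n + 1) K) (adeleAddChar K) (invQuot (AdelicGroupData.gl (n + 1) K) (smoothedForm (η i) ((f i : P.1.toSubmodule) : (AdelicGroupData.gl (n + 1) K).L2 μ))) (glDiagonal (n + 1) (AdeleRing (𝓞 K) K) τ * g))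
          (fun g => star (whittakerCoeff ν₀ (unipotentTateDomain (n + 1) K) (adeleAddChar K) (invQuot (AdelicGroupData.gl (n + 1) K) (smoothedForm (η i) ((f' i : Q.1.toSubmodule) : (AdelicGroupData.gl (n + 1) K).L2 μ)))) (glDiagonal (n + 1) (AdeleRing (𝓞 K) K) τ * g))
          (Φ i) s p ∂(νA.prod νK) = 1 := by
  intro hHJ n K _ _ μ _ _ _ νA _ νK _ ν₀ _ P Q hPQ S₀ hunr
  have hcpt : isCompact_glFiniteIntegralLevel (n + 1) K := isCompact_glFiniteIntegralLevel_holds (n + 1) K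
  -- the torus of Whittaker shifts off `S₀`
  obtain ⟨τ, S₁₀, hdisj, hDint, hlast, hDinf, hDS₀, hoff⟩ :=
    WhittakerShiftTorusOffIntegral.stub_whittakerShiftTorus_off_integral (n + 1) K S₀
  refine ⟨τ, hlast, hoff, ?_⟩
  -- the archimedean components of `π` and `σ`
  obtain ⟨E, _, _, _, τP, hτPi, hτPu, hτPc, hexP, -⟩ := exists_archComponent_decomposition (hcpt := hcpt) P
  obtain ⟨E', _, _, _, τQ, hτQi, hτQu, hτQc, hexQ, -⟩ := exists_archComponent_decomposition (hcpt := hcpt) Q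
  -- initial pure tensors of levels supported on `S₀`, with non-zero translated transferred functionals
  have h1 : 1 ≤ n + 1 := Nat.succ_le_succ (Nat.zero_le n)
  obtain ⟨𝔫P, h𝔫P, hsuppP, S₁, hS₁, w, hw⟩ :=
    InitialVectorTranslateNeZero.stub_initialVector_translate_ne_zero hcpt h1 P hτPu hτPi hτPc hexP ν₀ S₀
      (fun v hv => (hunr v hv).1) τ hDS₀ hoff
  obtain ⟨𝔫Q, h𝔫Q, hsuppQ, S₁', hS₁', w', hw'⟩ :=
    InitialVectorTranslateNeZero.stub_initialVector_translate_ne_zero hcpt h1 Q hτQu hτQi hτQc hexQ ν₀ S₀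
      (fun v hv => (hunr v hv).2) τ hDS₀ hoff
  -- the two archimedean Whittaker functionals
  have hlamP : IsContWhittakerFunctional P.1 (adeleAddChar K)
      (whittakerFunctional ν₀ (continuous_adeleAddChar K) (ContRepresentation.Equiv.refl P.1.toContRep)) :=
    isContWhittakerFunctional_whittakerFunctional ν₀ (continuous_adeleAddChar K) (isGlobalAddChar_adeleAddChar K) _
  have hlamQ : IsContWhittakerFunctional Q.1 (adeleAddChar K)
      (whittakerFunctional ν₀ (continuous_adeleAddChar K) (ContRepresentation.Equiv.refl Q.1.toContRep)) :=
    isContWhittakerFunctional_whittakerFunctional ν₀ (continuous_adeleAddChar K) (isGlobalAddChar_adeleAddChar K) _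
  have hℓ : IsArchContWhittakerFunctional hcpt τP hτPc
      (transferMap (whittakerFunctional ν₀ (continuous_adeleAddChar K) (ContRepresentation.Equiv.refl P.1.toContRep)) hτPc
        (finComponentRep hcpt τP P.1 (GLn.sndHom (n + 1) K (glDiagonal (n + 1) (AdeleRing (𝓞 K) K) τ)) S₁)) :=
    transferMap_mem_archContWhittakerFunctionals hlamP hτPc _
  have hℓ' : IsArchContWhittakerFunctional hcpt τQ hτQc
      (transferMap (whittakerFunctional ν₀ (continuous_adeleAddChar K) (ContRepresentation.Equiv.refl Q.1.toContRep)) hτQc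
        (finComponentRep hcpt τQ Q.1 (GLn.sndHom (n + 1) K (glDiagonal (n + 1) (AdeleRing (𝓞 K) K) τ)) S₁')) :=
    transferMap_mem_archContWhittakerFunctionals hlamQ hτQc _
  have hℓ0 : transferMap (whittakerFunctional ν₀ (continuous_adeleAddChar K) (ContRepresentation.Equiv.refl P.1.toContRep)) hτPc
      (finComponentRep hcpt τP P.1 (GLn.sndHom (n + 1) K (glDiagonal (n + 1) (AdeleRing (𝓞 K) K) τ)) S₁) ≠ 0 := by
    intro h
    apply hw
    rw [h, LinearMap.zero_apply]
  have hℓ'0 : transferMap (whittakerFunctional ν₀ (continuous_adeleAddChar K) (ContRepresentation.Equiv.refl Q.1.toContRep)) hτQc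
      (finComponentRep hcpt τQ Q.1 (GLn.sndHom (n + 1) K (glDiagonal (n + 1) (AdeleRing (𝓞 K) K) τ)) S₁') ≠ 0 := by
    intro h
    apply hw'
    rw [h, LinearMap.zero_apply]
  -- Borel structures on `GL_{n+1}(K_∞)` and `K_∞ˣ`, and the image Haar measures
  letI : MeasurableSpace (GL (Fin (n + 1)) (mixedSpace K)) := borel _
  haveI : BorelSpace (GL (Fin (n + 1)) (mixedSpace K)) := ⟨rfl⟩
  haveI := locallyCompactSpace_ideleGroup K
  have hμA := isHaarMeasure_map_archTorusOfIdele (n := n + 1) νA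
  have hμK := isHaarMeasure_map_kinfOfMaximalCompact (n := n + 1) νK
  -- the archimedean data from the named fact
  obtain ⟨mH, e, e', hefin, he'fin, Φinf, hΦc, hΦ0, hΦS, Λ, hΛ, hsum⟩ :=
    archPairLFactorData_of_testVector (hHJ (n + 1) K) hcpt E τP hτPc hτPu hτPi _ hℓ hℓ0 E' τQ hτQc hτQu hτQi _ hℓ' hℓ'0
      ((νA.restrict (unitBox (Set.univ : Set (HeightOneSpectrum (𝓞 K))))).map (archTorusOfIdele (n + 1) K))
      hμA (νK.map (kinfOfMaximalCompact (n + 1) K)) hμK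
  -- the realisation of every datum in the translated thin box integral
  have hsupp : ∀ w : HeightOneSpectrum (𝓞 K), w.asIdeal ∣ 𝔫P * 𝔫Q → w ∈ S₀ := by
    intro w hw
    rcases w.prime.dvd_or_dvd hw with h | h
    · exact hsuppP w h
    · exact hsuppQ w h
  have hM1 := fun i : Fin mH =>
    LocalSingleDatum.stub_local_single_datum hcpt P Q νA νK ν₀ hτPc hτQc S₀ S₁₀ hdisj τ hlast hDinf hDS₀ hDint
      h𝔫P h𝔫Q hsupp hPQ S₁ hS₁ S₁' hS₁' (e i) (e' i) (hefin i) (he'fin i)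
  choose 𝔫 h𝔫 hsupp𝔫 f f' η hη hηK m κ hκ hbox using hM1
  -- the data
  refine ⟨mH, fun i => (((κ i : ℝ) : ℂ))⁻¹, f, f', ∏ i, 𝔫 i, ?_, ?_, η, hη, ?_,
    fun i => thinTestFun (n + 1) K (Φinf i) S₀ (m i), ?_, ?_, ?_, ?_, ?_, Λ, hΛ, ?_⟩
  · exact Finset.prod_ne_zero_iff.2 fun i _ => h𝔫 i
  · intro w hw
    obtain ⟨i, hi⟩ := exists_dvd_of_dvd_prod 𝔫 hw
    exact hsupp𝔫 i w hi
  · intro i u hu g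
    refine hηK i u ?_ g
    exact principalCongruenceLevel_mono (n + 1) K (Finset.prod_ne_zero_iff.2 fun i _ => h𝔫 i)
      (Ideal.prod_le_inf.trans (Finset.inf_le (Finset.mem_univ i))) hu
  · exact fun i => continuous_thinTestFun_of_continuous (hΦc i) S₀ (m i)
  · exact fun i y => thinTestFun_nonneg (hΦ0 i) S₀ (m i) y
  · intro i
    obtain ⟨Ψ, hΨ⟩ := hΦS i
    exact ofReal_thinTestFun_mem_piSchwartzBruhat hΨ S₀ (m i)
  · exact fun i v hv => isLastRowSphericalAt_thinTestFun (Φinf i) (m i) hv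
  · exact fun i v _ y hy j => thinTestFun_ne_zero_valued_le_one hy j v
  · intro s hs
    rw [← hsum s hs]
    congr 1
    refine Finset.sum_congr rfl fun i _ => ?_
    rw [hbox i (Φinf i) (hΦc i) s, ← mul_assoc, inv_mul_cancel₀
      (Complex.ofReal_ne_zero.2 (hκ i).ne'), one_mul]

end Summit.Langlands.Langlands.Theorems.LocalPairTranslate

end
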